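import Literature.IUT.HodgeTheaters.TemperedCoveringsProp24Sub
import HarnessLib

/-!
# [IUTchI] Prop. 2.4 (ii): the inverse-limit step (INV) for the QUOTIENT tower REDUCED to tempered
# completeness + separation — PROOFS

Mochizuki, *Inter-universal Teichmüller theory I*, kurims manuscript (May 2020), §2, Proposition 2.4 (ii),
proof p. 51 l. 6–13: "Now [just as in the proof of assertion (i)] by applying [the evident analogue of] this
observation to the quotients `Π^tp_X ↠ Π^tp_X/Ker(J ↠ Π^tp_{𝔾*_J})` … we conclude that `γ ∈ Π^tp_X`"
[cite: Mochizuki2012, Prop 2.4(ii) p.51] (D-0012 claim key; nothing of the series is asserted here).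
PROOF-ONLY companion (seat abc-iut-w4-d055) of abc-iut-w5-d119's `TemperedCoveringsProp24Sub.lean`
(plan/L5/SUBDAG-IUTchI-Prop24.md row P24ii.r14), where (INV) for (ii) is the named sub-node
`Prop24QTower.QDetectsTempered` ("an element of `Π̂_X` tempered in every level quotient is tempered"),
the analogue for the quotient tower of `Prop24Tower.DetectsTempered` — which abc-iut-L5-t11 reduced to its
tempered half in `TemperedCoveringsProp24InvLimit.lean`.  The same reduction for the quotient tower
(`Prop24QTower.qDetectsTempered_of_inverseLimit`): `QDetectsTempered` follows from
* `hsurj` — the level maps `Π^tp_X → Π^tp_X/Ker(J ↠ Π^tp_{𝔾*_J})` are surjective (they are quotient maps);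
* `hlim` — TEMPERED completeness: every family of cosets `t_j·K_j` (`K_j := ι⁻¹ Ker(Π̂_X ↠ Π̂_X/…)`),
  compatible whenever one kernel contains another, is the family of cosets of one `s ∈ Π^tp_X`
  ("`Π^tp_X` may be written as an inverse limit of the `Π^tp_X/Ker(J ↠ Π^tp_{𝔾*_J})`", p. 50 l. 40–41
  transported to (ii));
* `hsep` — PROFINITE separation: `⋂_j Ker(Π̂_X ↠ Π̂_X/Ker(Δ̂_X ↠ Π̂_{𝔾*_J})) = {1}` (the only use of
  "`Π̂_X` may be written as an inverse limit …").
The quotient tower `Prop24QTower` carries no order on its levels, so no directedness is assumed: it is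
implicit in `hlim`.  Capstone `prop24ii_of_sub_of_inverseLimit`.  No new definition; nothing here bears on
[IUTchIII] Cor. 3.12.
-/

namespace Literature.IUT.HodgeTheaters

universe u

namespace StableCurveTemperedData

variable {D : StableCurveTemperedData.{u}}

namespace Prop24QTower

variable (T : D.Prop24QTower)

/-- The tempered trace of a level kernel: `t ∈ Π^tp_X` dies in the level-`j` quotient of `Π̂_X` iff it dies
in the level-`j` quotient of `Π^tp_X` (compatibility `hq` and injectivity of `Π^tp ↪ Π̂` at the level).
[cite: Mochizuki2012, Prop 2.4(ii) p.51] -/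
theorem qhat_ιX_eq_one_iff (j : T.I) (t : D.PiTp) : T.qhat j (D.ιX t) = 1 ↔ T.qtp j t = 1 := by
  rw [← T.hq j t]
  constructor
  · intro h
    exact (T.Q j).ι_injective (by rw [h, map_one])
  · intro h
    rw [h, map_one]

/-- **(INV) for the quotient tower, `QDetectsTempered`, DERIVED** from level surjectivity, tempered
completeness in coset form, and profinite separation (p. 51 l. 6–13 "just as in the proof of assertion (i)").
Proof: if `q̂_j(γ)` is tempered at every level, `q̂_j(γ) = q̂_j(ι t_j)` for tempered `t_j` (surjectivity +
compatibility); the `t_j` are compatible, so `hlim` gives one `s` with `ι(s⁻¹ t_j) ∈ Ker q̂_j` for all `j`,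
whence `ι(s)⁻¹γ ∈ ⋂_j Ker q̂_j = {1}`. [cite: Mochizuki2012, Prop 2.4(ii) p.51] -/
theorem qDetectsTempered_of_inverseLimit (hsurj : ∀ j, Function.Surjective (T.qtp j))
    (hlim : ∀ t : T.I → D.PiTp,
      (∀ j k, (T.qhat k).ker ≤ (T.qhat j).ker → D.ιX ((t j)⁻¹ * t k) ∈ (T.qhat j).ker) →
      ∃ s : D.PiTp, ∀ j, D.ιX (s⁻¹ * t j) ∈ (T.qhat j).ker)
    (hsep : ∀ δ : D.PiHat, (∀ j, T.qhat j δ = 1) → δ = 1) : T.QDetectsTempered := by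
  intro γ hγ
  classical
  -- tempered representatives `t_j` with `q̂_j(ι t_j) = q̂_j(γ)`
  have key : ∀ j, ∃ t : D.PiTp, T.qhat j (D.ιX t) = T.qhat j γ := by
    intro j
    obtain ⟨y, hy⟩ := hγ j
    obtain ⟨t, rfl⟩ := hsurj j y
    exact ⟨t, by rw [← T.hq j t, hy]⟩
  choose t ht using key
  have hker : ∀ j, (D.ιX (t j))⁻¹ * γ ∈ (T.qhat j).ker := by
    intro j
    rw [MonoidHom.mem_ker, map_mul, map_inv, ht j, inv_mul_cancel]
  -- compatibility of the family
  have hcompat : ∀ j k, (T.qhat k).ker ≤ (T.qhat j).ker → D.ιX ((t j)⁻¹ * t k) ∈ (T.qhat j).ker := by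
    intro j k hkj
    have e : D.ιX ((t j)⁻¹ * t k) = ((D.ιX (t j))⁻¹ * γ) * ((D.ιX (t k))⁻¹ * γ)⁻¹ := by
      simp only [map_mul, map_inv, mul_inv_rev, inv_inv]
      group
    rw [e]
    exact Subgroup.mul_mem _ (hker j) (Subgroup.inv_mem _ (hkj (hker k)))
  obtain ⟨s, hs⟩ := hlim t hcompat
  -- `ι(s)⁻¹ γ` dies at every level, hence is trivial
  have hone : (D.ιX s)⁻¹ * γ = 1 := by
    apply hsep
    intro j
    have e : (D.ιX s)⁻¹ * γ = D.ιX (s⁻¹ * t j) * ((D.ιX (t j))⁻¹ * γ) := by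
      simp only [map_mul, map_inv]
      group
    rw [e, map_mul, (MonoidHom.mem_ker).mp (hs j), (MonoidHom.mem_ker).mp (hker j), one_mul]
  rw [inv_mul_eq_one] at hone
  exact ⟨s, hone⟩

end Prop24QTower

/-- **[IUTchI] Prop. 2.4 (ii) from the quotient tower, with (INV) replaced by its tempered half**: the
level observation (OBS) (`LevelObservation`, the arithmetic analogue of Prop. 2.1 via [SemiAnbd] Thm 5.4
(ii) / Ex 5.6 and [NodNon] Prop 3.9 (i)), surjective level maps, tempered completeness `hlim`, profinite
separation `hsep`. [cite: Mochizuki2012, Prop 2.4(ii) p.51] -/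
theorem prop24ii_of_sub_of_inverseLimit (T : D.Prop24QTower) (hLev : T.LevelObservation)
    (hsurj : ∀ j, Function.Surjective (T.qtp j))
    (hlim : ∀ t : T.I → D.PiTp,
      (∀ j k, (T.qhat k).ker ≤ (T.qhat j).ker → D.ιX ((t j)⁻¹ * t k) ∈ (T.qhat j).ker) →
      ∃ s : D.PiTp, ∀ j, D.ιX (s⁻¹ * t j) ∈ (T.qhat j).ker)
    (hsep : ∀ δ : D.PiHat, (∀ j, T.qhat j δ = 1) → δ = 1) : D.Prop24ii :=
  T.prop24ii_of_qtower hLev (T.qDetectsTempered_of_inverseLimit hsurj hlim hsep)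

end StableCurveTemperedData

end Literature.IUT.HodgeTheaters
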